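import Summits.QuantumFields.BalabanUV.Beta.FP.ExpLocalisedBubbleMixed
import Summits.QuantumFields.BalabanUV.Beta.FP.BubbleSmearBridge

/-!
# `BalabanUV.Beta.FP.ExpLocalisedBubbleKernel` — road «FP», N7 H-route, row H2-ASM-1, part D (the END at kernel level): THE ONE-LOOP BUBBLE
# `ExpKernelCalculus.bubble A (V₀) (V₁)` OF A BOUNDED TRANSLATION-INVARIANT LEG AND TWO ZERO-MASS BI-LOCALISED VERTICES = Σ_{fibres} Lead + `O((‖z‖∞+1)^{−(a+b+3)})`
# ([folklore]; the junction `FP/BubbleSmearBridge` ∘ `FP/ExpLocalisedBubbleMixed`, nothing of the manuscripts)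

HONEST DEPENDENCY (page 1, mandatory): continuum YM on T⁴ ⇐ BetaPertH ∧ nine spine estimates (0/9 proved); BetaPertH ⇐ (D1) ∧ (D4) ∧
CAP+tail; G-an2-4 gates asym, D1 and NE2/3/4.  HONEST FRAMING (cell contract, verbatim): «discharging `BetaPertH` makes Bałaban's UV
stability UNCONDITIONAL — a real constructive-QFT result; it is NOT the continuum limit and NOT the Clay problem.»  THIS MODULE is wiring: the kernel-level bubble
(`FP/BubbleSmearBridge.bubble_eq_sum_smear`) against the double-smear expansion (`FP/ExpLocalisedBubbleMixed.abs_bubble_sub_lead_le`), fibre tuple by fibre tuple; every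
analytic input (bounded translation-invariant leg with graded letters to third differences for BOTH orientations `v ↦ A 0 (−v) a g` and `v ↦ A 0 v f h`, bi-localised vertices
with ZERO TOTAL MASS — H2V-DESIGN (a3) as corrected by N-leaf02-g38-1 ∕ E-FP-7-1: total, NOT per-leg) is a HYPOTHESIS; no `def`, no `Prop` fact, nothing cited, 0 sorry.  NOT the perfect bubble's VALUE (H2-ASM-2 supplies the letters of `Pker`, H2-ASM-3 the
germ identification), NOT `hgerm`, NOT D1, NOT BetaPertH, NOT continuum, NOT Clay.

CONTENT: **`abs_bubble_kernel_sub_lead_le`** — for EVERY `z`,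
`|bubble A V₀ V₁ − Σ_{a f g h} Lead_{afgh} z| ≤ |Φ|⁴·KR/(‖z‖∞+1)^{a+b+3}` with `Lead_{afgh}` the leading term of `FP/ExpLocalisedBubbleMixed` for the weights `c₀ p := V₀ p.1 p.2 g f`,
`c₁ q := V₁ (z+q.2) (z+q.1) h a` and legs `F v := A 0 (−v) a g`, `G v := A 0 v f h`, and `KR` its (written-out) remainder constant at the vertex constants `C₀, C₁`.
Unit `b2b-balaban-beta-d1-formalise-leaf-02` (gen 8).
-/

noncomputable section

namespace Summit.QuantumFields.BalabanUV.Beta.FP.ExpLocalisedBubbleKernel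

open Finset Filter Topology fwdDiff
open scoped BigOperators
open Literature.MathematicalPhysics.QuantumFieldTheory.Balaban1983to89
open Literature.MathematicalPhysics.QuantumFieldTheory.Balaban1983to89.Beta
open B12Sec2to5 (l1 l1_nonneg)
open ExpKernelCalculus (Site MKer Zl Zl_pos BiLoc bubble shiftK)
open Summit.QuantumFields.BalabanUV.Beta.FP.ExpLocalisedBubbleOrder2Point (Θ Zm K₀ K₁ K₂)
open Summit.QuantumFields.BalabanUV.Beta.FP.ExpLocalisedBubbleMixed (abs_bubble_sub_lead_le)
open Summit.QuantumFields.BalabanUV.Beta.FP.BubbleSmearBridge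
open DyadicShell (Pt supNorm)

variable {Φ : Type*} [Fintype Φ]
variable {A V₀ V₁ : MKer 4 Φ} {CA C₀ C₁ δ A₀ A₁ A₂ A₃ B₀ B₁ B₂ B₃ : ℝ} {a b : ℕ} {z : Pt}

omit [Fintype Φ] in
/-- [folklore] TOTAL MASS IS TRANSLATION∕SWAP INVARIANT: `Σ'_{q} W (z+q.2) (z+q.1) = Σ'_{q} W q.1 q.2` (the recentred, leg-swapped indexing of the vertex at `z` used by
`FP/ExpLocalisedBubbleMixed` has the same total mass; `Equiv.tsum_eq`, no summability needed). -/
theorem tsum_recentre (z : Pt) (W : Pt → Pt → ℝ) :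
    ∑' q : Pt × Pt, W (z + q.2) (z + q.1) = ∑' q : Pt × Pt, W q.1 q.2 := by
  let e : Pt × Pt ≃ Pt × Pt :=
    { toFun := fun q => (z + q.2, z + q.1)
      invFun := fun Q => (Q.2 - z, Q.1 - z)
      left_inv := fun q => by obtain ⟨x', w'⟩ := q; simp
      right_inv := fun Q => by obtain ⟨x, w⟩ := Q; simp }
  exact e.tsum_eq (fun Q : Pt × Pt => W Q.1 Q.2)

/-- **H2-ASM-1 AT KERNEL LEVEL**: bounded translation-invariant leg `A` whose two orientations `v ↦ A 0 (−v) a g`, `v ↦ A 0 v f h` carry the graded letters to third differences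
(uniformly in the fibre indices), vertices `V₀` (bi-localised at `(0,0)`) and `V₁` (at `(z,z)`) of ZERO TOTAL MASS in every fibre block ⟹
`|bubble A V₀ V₁ − Σ_{a f g h} Lead_{afgh} z| ≤ |Φ|⁴·KR/(‖z‖∞+1)^{a+b+3}`. [folklore] -/
theorem abs_bubble_kernel_sub_lead_le (hδ : 0 < δ) (hA : ∀ x y a' b', |A x y a' b'| ≤ CA) (hT : ∀ v : Pt, shiftK v A = A)
    (hV₀ : BiLoc V₀ 0 0 C₀ δ) (hV₁ : BiLoc V₁ z z C₁ δ)
    (h0₀ : ∀ (g f : Φ), ∑' p : Pt × Pt, V₀ p.1 p.2 g f = 0) (h0₁ : ∀ (h a' : Φ), ∑' q : Pt × Pt, V₁ q.1 q.2 h a' = 0)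
    (hF : ∀ (a' g : Φ) (t : Pt), |A 0 (-t) a' g| ≤ A₀ / ((supNorm t : ℝ) + 1) ^ a
      ∧ (∀ i, |Δ_[(Pi.single i 1 : Pt)] (fun v => A 0 (-v) a' g) t| ≤ A₁ / ((supNorm t : ℝ) + 1) ^ (a + 1))
      ∧ (∀ i j, |Δ_[(Pi.single i 1 : Pt)] (Δ_[(Pi.single j 1 : Pt)] (fun v => A 0 (-v) a' g)) t| ≤ A₂ / ((supNorm t : ℝ) + 1) ^ (a + 2))
      ∧ (∀ i j l, |Δ_[(Pi.single i 1 : Pt)] (Δ_[(Pi.single j 1 : Pt)] (Δ_[(Pi.single l 1 : Pt)] (fun v => A 0 (-v) a' g))) t| ≤ A₃ / ((supNorm t : ℝ) + 1) ^ (a + 3)))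
    (hG : ∀ (f h : Φ) (t : Pt), |A 0 t f h| ≤ B₀ / ((supNorm t : ℝ) + 1) ^ b
      ∧ (∀ i, |Δ_[(Pi.single i 1 : Pt)] (fun v => A 0 v f h) t| ≤ B₁ / ((supNorm t : ℝ) + 1) ^ (b + 1))
      ∧ (∀ i j, |Δ_[(Pi.single i 1 : Pt)] (Δ_[(Pi.single j 1 : Pt)] (fun v => A 0 v f h)) t| ≤ B₂ / ((supNorm t : ℝ) + 1) ^ (b + 2))
      ∧ (∀ i j l, |Δ_[(Pi.single i 1 : Pt)] (Δ_[(Pi.single j 1 : Pt)] (Δ_[(Pi.single l 1 : Pt)] (fun v => A 0 v f h))) t| ≤ B₃ / ((supNorm t : ℝ) + 1) ^ (b + 3))) :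
    |bubble A V₀ V₁
        - ∑ a', ∑ f, ∑ g, ∑ h, (-∑ i, ∑ j,
            ((∑' p : Pt × Pt, V₀ p.1 p.2 g f * (p.1 i : ℝ)) * (∑' p : Pt × Pt, V₁ (z + p.2) (z + p.1) h a' * (p.1 j : ℝ))
              * (A 0 z f h * Δ_[(Pi.single i 1 : Pt)] (Δ_[(Pi.single j 1 : Pt)] (fun v => A 0 (-v) a' g)) z)
            + (∑' p : Pt × Pt, V₀ p.1 p.2 g f * (p.1 i : ℝ)) * (∑' p : Pt × Pt, V₁ (z + p.2) (z + p.1) h a' * (p.2 j : ℝ))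
              * (Δ_[(Pi.single i 1 : Pt)] (fun v => A 0 (-v) a' g) z * Δ_[(Pi.single j 1 : Pt)] (fun v => A 0 v f h) z)
            + (∑' p : Pt × Pt, V₀ p.1 p.2 g f * (p.2 i : ℝ)) * (∑' p : Pt × Pt, V₁ (z + p.2) (z + p.1) h a' * (p.1 j : ℝ))
              * (Δ_[(Pi.single j 1 : Pt)] (fun v => A 0 (-v) a' g) z * Δ_[(Pi.single i 1 : Pt)] (fun v => A 0 v f h) z)
            + (∑' p : Pt × Pt, V₀ p.1 p.2 g f * (p.2 i : ℝ)) * (∑' p : Pt × Pt, V₁ (z + p.2) (z + p.1) h a' * (p.2 j : ℝ))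
              * (A 0 (-z) a' g * Δ_[(Pi.single i 1 : Pt)] (Δ_[(Pi.single j 1 : Pt)] (fun v => A 0 v f h)) z)))|
      ≤ (Fintype.card Φ : ℝ) ^ 4 * (A₀ * ((C₁ * Zl 4 δ) * (C₀ * Zl 4 δ) * K₂ δ B₀ B₁ B₂ B₃ b)
          + 4 * A₁ * ((C₁ * Zm δ 1) * (C₀ * Zl 4 δ) * K₁ δ B₀ B₁ B₂ b + (C₁ * Zl 4 δ) * (C₀ * Zm δ 1) * K₁ δ B₀ B₁ B₂ b)
          + B₀ * ((C₁ * Zl 4 δ) * (C₀ * Zl 4 δ) * K₂ δ A₀ A₁ A₂ A₃ a)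
          + (C₀ * C₁ * K₁ δ A₀ A₁ A₂ a) * K₀ δ B₀ B₁ b) / ((supNorm z : ℝ) + 1) ^ (a + b + 3) := by
  classical
  rw [bubble_eq_sum_smear hδ hA hT hV₀ hV₁]
  set KR : ℝ := (A₀ * ((C₁ * Zl 4 δ) * (C₀ * Zl 4 δ) * K₂ δ B₀ B₁ B₂ B₃ b)
          + 4 * A₁ * ((C₁ * Zm δ 1) * (C₀ * Zl 4 δ) * K₁ δ B₀ B₁ B₂ b + (C₁ * Zl 4 δ) * (C₀ * Zm δ 1) * K₁ δ B₀ B₁ B₂ b)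
          + B₀ * ((C₁ * Zl 4 δ) * (C₀ * Zl 4 δ) * K₂ δ A₀ A₁ A₂ A₃ a)
          + (C₀ * C₁ * K₁ δ A₀ A₁ A₂ a) * K₀ δ B₀ B₁ b) with hKR
  set N : ℝ := (supNorm z : ℝ) + 1 with hN
  -- each fibre tuple: the double smear of `FP/ExpLocalisedBubbleMixed`
  have key : ∀ a' f g h : Φ,
      |∑' P : (Pt × Pt) × (Pt × Pt), (V₀ P.1.1 P.1.2 g f) * (V₁ (z + P.2.2) (z + P.2.1) h a') * A 0 (-(z + P.2.1 - P.1.1)) a' g * A 0 (z + P.2.2 - P.1.2) f h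
        - (-∑ i, ∑ j,
            ((∑' p : Pt × Pt, V₀ p.1 p.2 g f * (p.1 i : ℝ)) * (∑' p : Pt × Pt, V₁ (z + p.2) (z + p.1) h a' * (p.1 j : ℝ))
              * (A 0 z f h * Δ_[(Pi.single i 1 : Pt)] (Δ_[(Pi.single j 1 : Pt)] (fun v => A 0 (-v) a' g)) z)
            + (∑' p : Pt × Pt, V₀ p.1 p.2 g f * (p.1 i : ℝ)) * (∑' p : Pt × Pt, V₁ (z + p.2) (z + p.1) h a' * (p.2 j : ℝ))
              * (Δ_[(Pi.single i 1 : Pt)] (fun v => A 0 (-v) a' g) z * Δ_[(Pi.single j 1 : Pt)] (fun v => A 0 v f h) z)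
            + (∑' p : Pt × Pt, V₀ p.1 p.2 g f * (p.2 i : ℝ)) * (∑' p : Pt × Pt, V₁ (z + p.2) (z + p.1) h a' * (p.1 j : ℝ))
              * (Δ_[(Pi.single j 1 : Pt)] (fun v => A 0 (-v) a' g) z * Δ_[(Pi.single i 1 : Pt)] (fun v => A 0 v f h) z)
            + (∑' p : Pt × Pt, V₀ p.1 p.2 g f * (p.2 i : ℝ)) * (∑' p : Pt × Pt, V₁ (z + p.2) (z + p.1) h a' * (p.2 j : ℝ))
              * (A 0 (-z) a' g * Δ_[(Pi.single i 1 : Pt)] (Δ_[(Pi.single j 1 : Pt)] (fun v => A 0 v f h)) z)))|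
        ≤ KR / N ^ (a + b + 3) := by
    intro a' f g h
    have hm := abs_bubble_sub_lead_le (c₀ := fun p : Pt × Pt => V₀ p.1 p.2 g f) (c₁ := fun q : Pt × Pt => V₁ (z + q.2) (z + q.1) h a')
      (F := fun v => A 0 (-v) a' g) (G := fun v => A 0 v f h) hδ (loc_vertex₀ hV₀ g f) (loc_vertex₁ hV₁ h a')
      (h0₀ g f) ((tsum_recentre z (fun x y => V₁ x y h a')).trans (h0₁ h a')) (hF a' g) (hG f h) z
    simpa only using hm
  -- sum over the fibre tuples
  have hcard : ∀ (s : ℝ), ∑ _a : Φ, ∑ _f : Φ, ∑ _g : Φ, ∑ _h : Φ, s = (Fintype.card Φ : ℝ) ^ 4 * s := fun s => by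
    simp only [Finset.sum_const, Finset.card_univ, nsmul_eq_mul]; ring
  rw [← Finset.sum_sub_distrib]
  refine (Finset.abs_sum_le_sum_abs _ _).trans ?_
  calc ∑ a', |∑ f, ∑ g, ∑ h, _ - ∑ f, ∑ g, ∑ h, _|
      ≤ ∑ _a' : Φ, ∑ _f : Φ, ∑ _g : Φ, ∑ _h : Φ, KR / N ^ (a + b + 3) := by
        refine Finset.sum_le_sum fun a' _ => ?_
        rw [← Finset.sum_sub_distrib]
        refine (Finset.abs_sum_le_sum_abs _ _).trans (Finset.sum_le_sum fun f _ => ?_)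
        rw [← Finset.sum_sub_distrib]
        refine (Finset.abs_sum_le_sum_abs _ _).trans (Finset.sum_le_sum fun g _ => ?_)
        rw [← Finset.sum_sub_distrib]
        exact (Finset.abs_sum_le_sum_abs _ _).trans (Finset.sum_le_sum fun h _ => key a' f g h)
    _ = (Fintype.card Φ : ℝ) ^ 4 * KR / N ^ (a + b + 3) := by rw [hcard]; ring

end Summit.QuantumFields.BalabanUV.Beta.FP.ExpLocalisedBubbleKernel

end
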